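import Summits.CriticalPhenomena.CardyFormulaZ2.Theorems.CardyComplexConeEdgePrecompactVertexRelation
import Summits.CriticalPhenomena.CardyFormulaZ2.Theorems.CardyComplexConeEdgePrecompactThreeSidedDomain
import Literature.Probability.LatticeModels.LatticeDobrushinBox
import Literature.Probability.Percolation.HalfPlaneArmAxisInputs
import Literature.Probability.Percolation.HalfPlaneOneArmQuasiMultiplicativity

/-!
# Necessity certificate, conclusion — preliminaries
(line `qkz-strip-boundary-arm` of crux `CardyComplexCone.EdgePrecompact`, stmt-CriticalPhenomena-11387;
necessity certificate "`UniformInnerEnvelope` ⇒ cube-root upper bound for the half-plane one-arm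
probability of bond-ℤ²", lead c4; registered sub-goal `threeSided_vertexRelations` + elementary lemmas
consumed by the core estimate `threeSided_fluxCoreEstimate` and the reduction
`halfPlaneArm_cubeRoot_of_conn_of_wallObs` of the next two files)

Contents.
* Piece B (real analysis): `∑_{k<n} (k+1)^{-1/3} ≤ (3/2) n^{2/3}` (`sum_range_rpow_neg_third_le`, integer-indexed
  form `sum_Ico_int_rpow_neg_third_le`), from the one-step concavity inequality
  `(x+1)^{-1/3} ≤ (3/2)((x+1)^{2/3} - x^{2/3})`, proved algebraically on the cube roots
  (`(u - v)² (u + 2v) ≥ 0` with `u³ - v³ = 1`); and the rpow identities `x · x^{-1/3} = x^{2/3}`,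
  `x^{2/3} / x = x^{-1/3}`, antitonicity of `t ↦ t^{-1/3}`, `n^{-1/3} ≤ 3 m^{-1/3}` for `m ≤ 3n`.
* Piece C (`threeSided_vertexRelations`, registered): the `q = 1` half-Cauchy–Riemann vertex relations of
  the corner observable (T1, `cornerObs_vertexRelation`, landed) at the interior vertical edges
  `{(x,y),(x,y+1)}`, `1 ≤ x ≤ W-1`, `0 ≤ y ≤ H-2`, and horizontal edges `{(x,y),(x+1,y)}`, `1 ≤ x ≤ W-2`,
  `0 ≤ y ≤ H-1`, of the three-sided box `LatticeDobrushin.threeSided W H` (endpoints off both discrete arcs,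
  both adjacent faces inner — the wall faces `(x,-1)` ARE inner faces), in exactly the index form consumed
  by the discrete Green regrouping `fluxBoundaryIdentity` (N2, landed).
* Monotonicity of the half-box one-arm probability in the scale (`real_halfBoxArm_anti`: the abstract
  layer's first-exit lemma `HalfPlaneArm.real_arm_anti` read through `HalfPlaneArm.axisArm_eq`).
* The projection `z ↦ Re (u z)` onto `u = e^{-iπ/3} = 1/2 - (√3/2) i` (`‖u‖ ≤ 1`, `Re (u r) = r/2`,
  `Re (u · i · e^{iπ/6} · r) = r/2`, `Re (u z) ≤ ‖z‖`): both wall phases of the core estimate project to `1/2`.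

References: H. Duminil-Copin, S. Smirnov, *Conformal invariance of lattice models*, arXiv:1109.1549, §8
(vertex relation, Prop. 8.6); P. Nolin, Electron. J. Probab. 13 (2008), §4.6 (arms in the half-plane).
-/

namespace Summit.CriticalPhenomena.CardyFormulaZ2.Cruxes.EdgePrecompact.QkzStripBoundaryArm

open MeasureTheory Filter Set Metric
open scoped Topology BigOperators Pointwise
open Literature.Probability.LatticeModels Literature.Probability.Percolation
open Literature.Probability.RandomPlanarGeometry (DobrushinDomain)
open Summit.CriticalPhenomena.CardyFormulaZ2.Theses.CardyComplexCone
open LatticeDobrushin Finset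

noncomputable section

/-! ## Piece B: the elementary sum bound -/


/-- Key one-step inequality (piece B of the necessity certificate's conclusion): `(n+1)^{-1/3} ≤ (3/2) ((n+1)^{2/3} - n^{2/3})` for real `n ≥ 0`
(concavity of `t ↦ t^{2/3}`, in the algebraic form `(u - v)² (u + 2v) ≥ 0` for the cube roots). -/
private theorem rpow_step_H7 (x : ℝ) (hx : 0 ≤ x) :
    (x + 1) ^ (-(1:ℝ) / 3) ≤ 3 / 2 * ((x + 1) ^ ((2:ℝ) / 3) - x ^ ((2:ℝ) / 3)) := by
  set u : ℝ := (x + 1) ^ ((1:ℝ) / 3) with hu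
  set v : ℝ := x ^ ((1:ℝ) / 3) with hv
  have hx1 : 0 < x + 1 := by linarith
  have hu0 : 0 < u := Real.rpow_pos_of_pos hx1 _
  have hv0 : 0 ≤ v := Real.rpow_nonneg hx _
  have hu3 : u ^ 3 = x + 1 := by
    rw [hu, ← Real.rpow_natCast, ← Real.rpow_mul hx1.le]; norm_num
  have hv3 : v ^ 3 = x := by
    rw [hv, ← Real.rpow_natCast, ← Real.rpow_mul hx]; norm_num
  have huv : v ≤ u := by
    rw [hu, hv]; exact Real.rpow_le_rpow hx (by linarith) (by norm_num)
  have h1 : (x + 1) ^ (-(1:ℝ) / 3) = u⁻¹ := by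
    rw [hu, ← Real.rpow_neg hx1.le]; norm_num
  have h2 : (x + 1) ^ ((2:ℝ) / 3) = u ^ 2 := by
    rw [hu, ← Real.rpow_natCast, ← Real.rpow_mul hx1.le]; norm_num
  have h3 : x ^ ((2:ℝ) / 3) = v ^ 2 := by
    rw [hv, ← Real.rpow_natCast, ← Real.rpow_mul hx]; norm_num
  rw [h1, h2, h3, inv_eq_one_div, div_le_iff₀ hu0]
  -- `1 ≤ (3/2) (u² - v²) u` from `u³ - v³ = 1` and `(u - v)² (u + 2v) ≥ 0`
  have hcube : u ^ 3 - v ^ 3 = 1 := by rw [hu3, hv3]; ring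
  have key : 3 / 2 * (u ^ 2 - v ^ 2) * u - 1 = 1 / 2 * (u - v) ^ 2 * (u + 2 * v) := by
    linear_combination hcube
  nlinarith [mul_nonneg (sq_nonneg (u - v)) (by linarith : 0 ≤ u + 2 * v)]

/-- `∑_{k<n} (k+1)^{-1/3} ≤ (3/2) n^{2/3}`. -/
theorem sum_range_rpow_neg_third_le (n : ℕ) :
    ∑ k ∈ range n, ((k : ℝ) + 1) ^ (-(1:ℝ) / 3) ≤ 3 / 2 * (n : ℝ) ^ ((2:ℝ) / 3) := by
  induction n with
  | zero => simp [Real.zero_rpow (by norm_num : ((2:ℝ) / 3) ≠ 0)]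
  | succ n ih =>
    rw [sum_range_succ, Nat.cast_succ]
    have := rpow_step_H7 (n : ℝ) (Nat.cast_nonneg n)
    linarith

/-- Integer-indexed form: `∑_{y ∈ [0, n)} (y+1)^{-1/3} ≤ (3/2) n^{2/3}` over `Finset.Ico (0:ℤ) n`. -/
theorem sum_Ico_int_rpow_neg_third_le (n : ℕ) :
    ∑ y ∈ Finset.Ico (0:ℤ) n, ((y : ℝ) + 1) ^ (-(1:ℝ) / 3) ≤ 3 / 2 * (n : ℝ) ^ ((2:ℝ) / 3) := by
  have h : Finset.Ico (0:ℤ) n = (range n).map Nat.castEmbedding := by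
    ext y
    simp only [Finset.mem_Ico, Finset.mem_map, Finset.mem_range, Nat.castEmbedding_apply]
    constructor
    · rintro ⟨h0, hn⟩
      refine ⟨y.toNat, by omega, by omega⟩
    · rintro ⟨k, hk, rfl⟩; omega
  rw [h, Finset.sum_map]
  simp only [Nat.castEmbedding_apply, Int.cast_natCast]
  exact sum_range_rpow_neg_third_le n



/-! ## Elementary real-power facts -/

/-- `n · n^{-1/3} = n^{2/3}` for `n > 0`. -/
theorem mul_rpow_neg_third {x : ℝ} (hx : 0 < x) : x * x ^ (-(1:ℝ) / 3) = x ^ ((2:ℝ) / 3) := by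
  conv_lhs => rw [show x * x ^ (-(1:ℝ) / 3) = x ^ (1:ℝ) * x ^ (-(1:ℝ) / 3) by rw [Real.rpow_one]]
  rw [← Real.rpow_add hx]; norm_num

/-- `x^{2/3} / x = x^{-1/3}` for `x > 0`. -/
theorem rpow_two_thirds_div {x : ℝ} (hx : 0 < x) : x ^ ((2:ℝ) / 3) / x = x ^ (-(1:ℝ) / 3) := by
  rw [div_eq_iff hx.ne', mul_comm, mul_rpow_neg_third hx]

/-- Antitonicity of `t ↦ t^{-1/3}` on positives. -/
theorem rpow_neg_third_antitone {x y : ℝ} (hx : 0 < x) (hxy : x ≤ y) :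
    y ^ (-(1:ℝ) / 3) ≤ x ^ (-(1:ℝ) / 3) :=
  Real.rpow_le_rpow_of_nonpos hx hxy (by norm_num)


/-- **Monotonicity of the half-box one-arm probability in the scale** (first exit; the abstract
layer's `real_arm_anti` read through `axisArm_eq`). -/
theorem real_halfBoxArm_anti {m m' : ℕ} (h : m' ≤ m) :
    (bondPercolation (zdGraph 2) half).real {ω : BondConfig (Site 2) | ∃ y : Site 2,
        (y 0 = (m : ℤ) ∨ y 0 = -(m : ℤ) ∨ y 1 = (m : ℤ)) ∧
        ω ∈ openConnIn {v : Site 2 | 0 ≤ v 1 ∧ -(m : ℤ) ≤ v 0 ∧ v 0 ≤ m ∧ v 1 ≤ m} 0 y} ≤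
    (bondPercolation (zdGraph 2) half).real {ω : BondConfig (Site 2) | ∃ y : Site 2,
        (y 0 = (m' : ℤ) ∨ y 0 = -(m' : ℤ) ∨ y 1 = (m' : ℤ)) ∧
        ω ∈ openConnIn {v : Site 2 | 0 ≤ v 1 ∧ -(m' : ℤ) ≤ v 0 ∧ v 0 ≤ m' ∧ v 1 ≤ m'} 0 y} := by
  rw [HalfPlaneArm.axisArm_eq m, HalfPlaneArm.axisArm_eq m']
  exact HalfPlaneArm.real_arm_anti (X := fun v : Site 2 => v 0) (Y := fun v : Site 2 => v 1)
    HalfPlaneArm.axis_X_le HalfPlaneArm.axis_Y_le half 0 (by positivity) (by exact_mod_cast h)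

/-- `n^{-1/3} ≤ 3 · m^{-1/3}` when `0 < m ≤ 3n`. -/
theorem rpow_neg_third_le_of_le_three_mul {n m : ℝ} (hm : 0 < m) (h : m ≤ 3 * n) :
    n ^ (-(1:ℝ) / 3) ≤ 3 * m ^ (-(1:ℝ) / 3) := by
  have h1 : n ^ (-(1:ℝ) / 3) ≤ (m / 3) ^ (-(1:ℝ) / 3) :=
    rpow_neg_third_antitone (by positivity) (by linarith)
  have h2 : (m / 3) ^ (-(1:ℝ) / 3) = (3:ℝ) ^ ((1:ℝ) / 3) * m ^ (-(1:ℝ) / 3) := by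
    rw [show (-(1:ℝ) / 3) = -((1:ℝ) / 3) by ring, Real.rpow_neg (by positivity), Real.rpow_neg hm.le,
      Real.div_rpow hm.le (by norm_num)]
    field_simp
  have h3 : (3:ℝ) ^ ((1:ℝ) / 3) ≤ 3 := by
    conv_rhs => rw [← Real.rpow_one 3]
    exact Real.rpow_le_rpow_of_exponent_le (by norm_num) (by norm_num)
  rw [h2] at h1
  exact h1.trans (mul_le_mul_of_nonneg_right h3 (Real.rpow_nonneg hm.le _))


/-! ## The projection `z ↦ Re (u z)`, `u = e^{-iπ/3}`, and the two wall phases -/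

/-- `‖u‖ ≤ 1` for `u = e^{-iπ/3} = 1/2 - (√3/2) i` (in fact `= 1`), the direction onto which the contour
identity is projected by the core estimate: both wall phases `1` and `i · e^{iπ/6} = e^{2iπ/3}` have
projection `1/2` on it. -/
theorem norm_uProj_le_one : ‖(⟨1 / 2, -(Real.sqrt 3 / 2)⟩ : ℂ)‖ ≤ 1 := by
  have h3 : Real.sqrt 3 ^ 2 = 3 := Real.sq_sqrt (by norm_num)
  have : ‖(⟨1 / 2, -(Real.sqrt 3 / 2)⟩ : ℂ)‖ ^ 2 = 1 := by
    rw [Complex.sq_norm, Complex.normSq_apply]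
    simp only
    nlinarith [h3]
  nlinarith [norm_nonneg (⟨1 / 2, -(Real.sqrt 3 / 2)⟩ : ℂ)]

/-- Projection of a real wall term: `Re (u · r) = r/2`. -/
theorem re_uProj_mul_ofReal (r : ℝ) : ((⟨1 / 2, -(Real.sqrt 3 / 2)⟩ : ℂ) * (r : ℂ)).re = r / 2 := by
  simp [Complex.mul_re]; ring

/-- `e^{iπ/6} = √3/2 + i/2`. -/
theorem exp_pi_div_six_mul_I : Complex.exp (Real.pi / 6 * Complex.I) = ⟨Real.sqrt 3 / 2, 1 / 2⟩ := by
  have h : Complex.exp (Real.pi / 6 * Complex.I) =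
      Complex.cos ((Real.pi / 6 : ℝ) : ℂ) + Complex.sin ((Real.pi / 6 : ℝ) : ℂ) * Complex.I := by
    rw [← Complex.exp_mul_I]; push_cast; ring_nf
  rw [h, ← Complex.ofReal_cos, ← Complex.ofReal_sin, Real.cos_pi_div_six, Real.sin_pi_div_six]
  apply Complex.ext <;> simp

/-- Projection of the second wall family: `Re (u · (i · (e^{iπ/6} · r))) = r/2`. -/
theorem re_uProj_mul_I_exp (r : ℝ) :
    ((⟨1 / 2, -(Real.sqrt 3 / 2)⟩ : ℂ) * (Complex.I * (Complex.exp (Real.pi / 6 * Complex.I) * (r : ℂ)))).re = r / 2 := by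
  rw [exp_pi_div_six_mul_I]
  have h3 : Real.sqrt 3 * Real.sqrt 3 = 3 := Real.mul_self_sqrt (by norm_num)
  have hprod : (⟨1 / 2, -(Real.sqrt 3 / 2)⟩ : ℂ) * (Complex.I * (⟨Real.sqrt 3 / 2, 1 / 2⟩ : ℂ)) =
      ⟨1 / 2, Real.sqrt 3 / 2⟩ := by
    apply Complex.ext
    · simp [Complex.mul_re, Complex.mul_im]; linarith [h3]
    · simp [Complex.mul_re, Complex.mul_im]; ring
  have hassoc : (⟨1 / 2, -(Real.sqrt 3 / 2)⟩ : ℂ) * (Complex.I * ((⟨Real.sqrt 3 / 2, 1 / 2⟩ : ℂ) * (r : ℂ))) =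
      ((⟨1 / 2, -(Real.sqrt 3 / 2)⟩ : ℂ) * (Complex.I * (⟨Real.sqrt 3 / 2, 1 / 2⟩ : ℂ))) * (r : ℂ) := by ring
  rw [hassoc, hprod]
  simp [Complex.mul_re]; ring

/-- `Re (u z) ≤ ‖z‖`. -/
theorem re_uProj_mul_le_norm (z : ℂ) : ((⟨1 / 2, -(Real.sqrt 3 / 2)⟩ : ℂ) * z).re ≤ ‖z‖ :=
  calc ((⟨1 / 2, -(Real.sqrt 3 / 2)⟩ : ℂ) * z).re ≤ ‖(⟨1 / 2, -(Real.sqrt 3 / 2)⟩ : ℂ) * z‖ := Complex.re_le_norm _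
    _ = ‖(⟨1 / 2, -(Real.sqrt 3 / 2)⟩ : ℂ)‖ * ‖z‖ := norm_mul _ _
    _ ≤ 1 * ‖z‖ := mul_le_mul_of_nonneg_right norm_uProj_le_one (norm_nonneg _)
    _ = ‖z‖ := one_mul _

/-! ## Piece C: the vertex relations in the three-sided box -/

/-- `![x, y] + e₁ = ![x, y + 1]`. -/
private theorem vec_add_e1_H7 (x y : ℤ) : (![x, y] : Site 2) + Pi.single 1 1 = ![x, y + 1] := by
  ext i; fin_cases i <;> simp

/-- `![x, y] + e₀ = ![x + 1, y]`. -/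
private theorem vec_add_e0_H7 (x y : ℤ) : (![x, y] : Site 2) + Pi.single 0 1 = ![x + 1, y] := by
  ext i; fin_cases i <;> simp

/-- **The vertex relations of the corner observable in the three-sided box** (T1 =
`cornerObs_vertexRelation` instantiated at the interior edges of `threeSided W H`, in the index form
of `fluxBoundaryIdentity`): with `Fc x y k := cornerObs E 1 (x,y) (faceAt (x,y) k)`, the VERTICAL
relation `Fc x y 1 - Fc x (y+1) 3 = i (Fc x (y+1) 2 - Fc x y 0)` holds at every vertical edge
`{(x,y),(x,y+1)}` with `1 ≤ x ≤ W-1`, `0 ≤ y ≤ H-2`, and the HORIZONTAL relation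
`Fc x y 0 - Fc (x+1) y 2 = i (Fc (x+1) y 1 - Fc x y 3)` at every horizontal edge `{(x,y),(x+1,y)}`
with `1 ≤ x ≤ W-2`, `0 ≤ y ≤ H-1` (endpoints off both discrete arcs, both adjacent faces inner;
the wall faces `(x,-1)` ARE inner faces of the three-sided box). -/
theorem threeSided_vertexRelations : ∀ (W H : ℕ), 1 ≤ W → 1 ≤ H → (∀ x y : ℤ, 1 ≤ x → x + 1 ≤ W → 0 ≤ y → y + 2 ≤ H → cornerObs (LatticeDobrushin.threeSided W H).toDobrushin 1 ![x, y] (faceAt ![x, y] 1) - cornerObs (LatticeDobrushin.threeSided W H).toDobrushin 1 ![x, y + 1] (faceAt ![x, y + 1] 3) = Complex.I * (cornerObs (LatticeDobrushin.threeSided W H).toDobrushin 1 ![x, y + 1] (faceAt ![x, y + 1] 2) - cornerObs (LatticeDobrushin.threeSided W H).toDobrushin 1 ![x, y] (faceAt ![x, y] 0))) ∧ (∀ x y : ℤ, 1 ≤ x → x + 2 ≤ W → 0 ≤ y → y + 1 ≤ H → cornerObs (LatticeDobrushin.threeSided W H).toDobrushin 1 ![x, y] (faceAt ![x, y] 0)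 - cornerObs (LatticeDobrushin.threeSided W H).toDobrushin 1 ![x + 1, y] (faceAt ![x + 1, y] 2) = Complex.I * (cornerObs (LatticeDobrushin.threeSided W H).toDobrushin 1 ![x + 1, y] (faceAt ![x + 1, y] 1) - cornerObs (LatticeDobrushin.threeSided W H).toDobrushin 1 ![x, y] (faceAt ![x, y] 3))) := by
  intro W H hW hH
  obtain ⟨D, hD⟩ := exists_dobrushinDomain_threeSided W H
  have hE : (threeSided W H).toDobrushin.IsZdAdmissible := isZdAdmissible_threeSided hW hH
  have hδ : (threeSided W H).toDobrushin.δ = 1 := rfl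
  -- membership tests
  have memS : ∀ x y : ℤ, 0 ≤ x → x ≤ W → -1 ≤ y → y ≤ H → (![x, y] : Site 2) ∈ (threeSided W H).S := by
    intro x y h1 h2 h3 h4
    rw [mem_threeSided_S]; simp; omega
  have notA : ∀ x y : ℤ, 1 ≤ x → x + 1 ≤ W → y + 1 ≤ H →
      (![x, y] : Site 2) ∉ (threeSided W H).toDobrushin.zdArcA := by
    intro x y h1 h2 h3 h
    rw [zdArcA_threeSided, mem_threeSided_A] at h
    simp at h; omega
  have notB : ∀ x y : ℤ, 0 ≤ y → (![x, y] : Site 2) ∉ (threeSided W H).toDobrushin.zdArcB := by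
    intro x y h1 h
    rw [zdArcB_threeSided] at h
    simp at h; omega
  have inner : ∀ f0 f1 : ℤ, 0 ≤ f0 → f0 + 1 ≤ W → -1 ≤ f1 → f1 + 1 ≤ H →
      (threeSided W H).toDobrushin.IsInnerFace ![f0, f1] := by
    intro f0 f1 h1 h2 h3 h4
    rw [isInnerFace_threeSided_iff]; simp; omega
  have edge : ∀ u w : Site 2, (zdGraph 2).Adj u w → u ∈ (threeSided W H).S → w ∈ (threeSided W H).S →
      s(u, w) ∈ (discreteDomainGraph (threeSided W H).toDobrushin.Ω (threeSided W H).toDobrushin.δ).edgeSet := by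
    intro u w huw hu hw
    exact (threeSided W H).mem_edgeSet_iff.2 ⟨huw, hu, hw⟩
  refine ⟨?_, ?_⟩
  · intro x y hx1 hxW hy0 hyH
    -- vertical edge `{(x,y), (x,y+1)}`: coded corner `p = ((x,y), 0)`
    have hT : cTgt ((![x, y], 0) : Site 2 × Fin 4) = s(![x, y], ![x, y + 1]) := by
      show s(![x, y], ![x, y] + cornerUnit (0 + 1)) = _
      rw [show (0 : Fin 4) + 1 = 1 by decide, show cornerUnit 1 = Pi.single 1 1 from rfl, vec_add_e1_H7]
    have hadj : (zdGraph 2).Adj (![x, y] : Site 2) ![x, y + 1] := by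
      rw [← vec_add_e1_H7]; exact (zdGraph_two_adj_iff_add _ _).2 (by simp)
    have key := cornerObs_vertexRelation D hD.symm hE (p := (![x, y], 0))
      (by rw [hT]; exact edge _ _ hadj (memS x y (by omega) (by omega) (by omega) (by omega))
            (memS x (y + 1) (by omega) (by omega) (by omega) (by omega)))
      (by
        rw [hT]; intro z hz
        rcases Sym2.mem_iff.1 hz with rfl | rfl
        · exact ⟨notA x y hx1 hxW (by omega), notB x y hy0⟩
        · exact ⟨notA x (y + 1) hx1 hxW (by omega), notB x (y + 1) (by omega)⟩)
      (by
        show (threeSided W H).toDobrushin.IsInnerFace (faceAt ![x, y] 0)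
        have : faceAt (![x, y] : Site 2) 0 = ![x, y] := by simp [faceAt, cornerOff]
        rw [this]; exact inner x y (by omega) hxW (by omega) (by omega))
      (by
        rw [show (0 : Fin 4) + 1 = 1 by decide]
        have : faceAt (![x, y] : Site 2) 1 = ![x - 1, y] := by
          ext i; fin_cases i <;> simp [faceAt, cornerOff]
        rw [this]; exact inner (x - 1) y (by omega) (by omega) (by omega) (by omega))
    have e1 : cFace ((![x, y], (0 : Fin 4) + 1) : Site 2 × Fin 4) = faceAt ![x, y] 1 := by
      rw [show (0 : Fin 4) + 1 = 1 by decide]; rfl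
    have e2 : (![x, y] : Site 2) + cornerUnit ((0 : Fin 4) + 1) = ![x, y + 1] := by
      rw [show (0 : Fin 4) + 1 = 1 by decide, show cornerUnit 1 = Pi.single 1 1 from rfl, vec_add_e1_H7]
    have e3 : ∀ v : Site 2, cFace ((v, (0 : Fin 4) + 3) : Site 2 × Fin 4) = faceAt v 3 := by
      intro v; rw [show (0 : Fin 4) + 3 = 3 by decide]; rfl
    have e4 : cornerPartner ((![x, y], 0) : Site 2 × Fin 4) = (![x, y + 1], 2) := by
      show (![x, y] + cornerUnit (0 + 1), (0 : Fin 4) + 2) = _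
      rw [e2, show (0 : Fin 4) + 2 = 2 by decide]
    have e5 : ∀ v : Site 2, cFace ((v, 2) : Site 2 × Fin 4) = faceAt v 2 := fun v => rfl
    have e6 : cFace ((![x, y], 0) : Site 2 × Fin 4) = faceAt ![x, y] 0 := rfl
    simp only [e1, e2, e3, e4, e5, e6, hδ] at key
    exact key
  · intro x y hx1 hxW hy0 hyH
    -- horizontal edge `{(x,y), (x+1,y)}`: coded corner `p = ((x,y), 3)`
    have hT : cTgt ((![x, y], 3) : Site 2 × Fin 4) = s(![x, y], ![x + 1, y]) := by
      show s(![x, y], ![x, y] + cornerUnit (3 + 1)) = _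
      rw [show (3 : Fin 4) + 1 = 0 by decide, show cornerUnit 0 = Pi.single 0 1 from rfl, vec_add_e0_H7]
    have hadj : (zdGraph 2).Adj (![x, y] : Site 2) ![x + 1, y] := by
      rw [← vec_add_e0_H7]; exact (zdGraph_two_adj_iff_add _ _).2 (by simp)
    have key := cornerObs_vertexRelation D hD.symm hE (p := (![x, y], 3))
      (by rw [hT]; exact edge _ _ hadj (memS x y (by omega) (by omega) (by omega) (by omega))
            (memS (x + 1) y (by omega) (by omega) (by omega) (by omega)))
      (by
        rw [hT]; intro z hz
        rcases Sym2.mem_iff.1 hz with rfl | rfl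
        · exact ⟨notA x y hx1 (by omega) (by omega), notB x y hy0⟩
        · exact ⟨notA (x + 1) y (by omega) (by omega) (by omega), notB (x + 1) y hy0⟩)
      (by
        show (threeSided W H).toDobrushin.IsInnerFace (faceAt ![x, y] 3)
        have : faceAt (![x, y] : Site 2) 3 = ![x, y - 1] := by
          ext i; fin_cases i <;> simp [faceAt, cornerOff]
        rw [this]; exact inner x (y - 1) (by omega) (by omega) (by omega) (by omega))
      (by
        rw [show (3 : Fin 4) + 1 = 0 by decide]
        have : faceAt (![x, y] : Site 2) 0 = ![x, y] := by simp [faceAt, cornerOff]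
        rw [this]; exact inner x y (by omega) (by omega) (by omega) (by omega))
    have e1 : cFace ((![x, y], (3 : Fin 4) + 1) : Site 2 × Fin 4) = faceAt ![x, y] 0 := by
      rw [show (3 : Fin 4) + 1 = 0 by decide]; rfl
    have e2 : (![x, y] : Site 2) + cornerUnit ((3 : Fin 4) + 1) = ![x + 1, y] := by
      rw [show (3 : Fin 4) + 1 = 0 by decide, show cornerUnit 0 = Pi.single 0 1 from rfl, vec_add_e0_H7]
    have e3 : ∀ v : Site 2, cFace ((v, (3 : Fin 4) + 3) : Site 2 × Fin 4) = faceAt v 2 := by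
      intro v; rw [show (3 : Fin 4) + 3 = 2 by decide]; rfl
    have e4 : cornerPartner ((![x, y], 3) : Site 2 × Fin 4) = (![x + 1, y], 1) := by
      show (![x, y] + cornerUnit (3 + 1), (3 : Fin 4) + 2) = _
      rw [e2, show (3 : Fin 4) + 2 = 1 by decide]
    have e5 : ∀ v : Site 2, cFace ((v, 1) : Site 2 × Fin 4) = faceAt v 1 := fun v => rfl
    have e6 : cFace ((![x, y], 3) : Site 2 × Fin 4) = faceAt ![x, y] 3 := rfl
    simp only [e1, e2, e3, e4, e5, e6, hδ] at key
    exact key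

end

end Summit.CriticalPhenomena.CardyFormulaZ2.Cruxes.EdgePrecompact.QkzStripBoundaryArm
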